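import Mathlib.Data.Nat.Choose.Basic
import Mathlib.Algebra.BigOperators.Intervals
import Mathlib.Algebra.Order.BigOperators.Group.Finset
import Mathlib.Tactic
import Literature.Barriers.ValiantsHypothesis.ShiftedPartialsCaseC2
import HarnessLib

/-!
# Hypergeometric peakedness (EXTENDED LEMMA Φ of the CORE-LEMMA proof)

Support file for the Sahi / Conjecture-P programme of route `PercNearOneGluingNoHeavy`
(`--supports stmt-CriticalPhenomena-4575`, prover prim-l12-p5 gen 26; proof note
`prim-l12-p5/CORE-g26.md` §5.3).  No definitions, no named facts, no sorries.

Setting (note §5).  THEOREM DF1 (LSM-Z-2D for every single-type de Finetti bi-exchangeable law)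
is reduced there to the CORE LEMMA, and the CORE LEMMA to two 'peakedness' facts about the
hypergeometric family `X_k ~ Hyp(T; m; k)` (marked items among `k` draws from `T = L + m` items,
`m` of them marked): for `w : {0..m} → ℝ` symmetric about `m/2` and unimodal, `k ↦ E[w(X_k)]` is
nonincreasing for `k ≥ (T-1)/2` (EXTENDED LEMMA Φ).  Writing `X_{k+1} = X_k + ξ` with
`P(ξ = 1 | X_k = x) = (m-x)/(T-k)`, the increment `(T-k)·(E w(X_{k+1}) - E w(X_k))` equals
`∑_x A(x) (w(x+1) - w(x))` with `A(x) = C(m,x) (m-x) C(L,k-x)` (unnormalised), and the lemma is the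
statement that this sum is `≤ 0`.  This file proves exactly that, in three steps:

* `choose_le_choose_of_closer` : `C(L,p₂) ≤ C(L,p₁)` whenever `p₁ ≤ p₂` and `L ≤ p₁ + p₂` (of two
  indices the one closer to `L/2` has the larger binomial coefficient; monotonicity on the left half is
  reused from `Literature.Barriers.ValiantsHypothesis.choose_le_choose_of_le_half`);
* `reflect_sum_nonpos` : the abstract reflection/pairing argument `x ↔ m-1-x`;
* `ext_lemma_phi` : the concrete inequality `∑_{x<m} C(m,x)(m-x)C(L,k-x)·(w(x+1)-w(x)) ≤ 0` for
  `L + m ≤ 2k+1`, `w` symmetric and unimodal.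
-/

namespace Summit.CriticalPhenomena.PercolationContinuityZ3.Theorems

namespace HypergeomPeak

open Finset

/-- Of two indices `p₁ ≤ p₂` with `p₁ + p₂ ≥ L`, the smaller one is at least as close to `L/2`,
hence `C(L,p₂) ≤ C(L,p₁)`. -/
theorem choose_le_choose_of_closer {L p₁ p₂ : ℕ} (h12 : p₁ ≤ p₂) (hsum : L ≤ p₁ + p₂) :
    L.choose p₂ ≤ L.choose p₁ := by
  rcases lt_or_ge L p₂ with hL | hL
  · simp [Nat.choose_eq_zero_of_lt hL]
  · rcases le_or_gt p₁ (L / 2) with h1 | h1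
    · rw [← Nat.choose_symm hL]
      exact Literature.Barriers.ValiantsHypothesis.choose_le_choose_of_le_half (by omega) h1
    · have hp1L : p₁ ≤ L := le_trans h12 hL
      rw [← Nat.choose_symm hL, ← Nat.choose_symm hp1L]
      exact Literature.Barriers.ValiantsHypothesis.choose_le_choose_of_le_half (by omega) (by omega)

/-- The abstract reflection argument.  If `A` satisfies `A x ≤ A (m-1-x)` for `2x+2 ≤ m`, and
`w` is symmetric (`w x = w (m-x)`) and unimodal (`w x ≤ w (x+1)` for `2x+2 ≤ m`), then
`∑_{x<m} A x · (w (x+1) - w x) ≤ 0`.  (Pair `x` with `m-1-x`: the increments of `w` are opposite,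
and the weight of the nonpositive increment dominates.) -/
theorem reflect_sum_nonpos (m : ℕ) (A w : ℕ → ℝ)
    (hAref : ∀ x, 2 * x + 2 ≤ m → A x ≤ A (m - 1 - x))
    (hwsym : ∀ x, x ≤ m → w x = w (m - x))
    (hwuni : ∀ x, 2 * x + 2 ≤ m → w x ≤ w (x + 1)) :
    ∑ x ∈ range m, A x * (w (x + 1) - w x) ≤ 0 := by
  -- the reflected copy of the sum
  have hS : ∑ x ∈ range m, A x * (w (x + 1) - w x) =
      ∑ x ∈ range m, A (m - 1 - x) * (w x - w (x + 1)) := by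
    rw [← sum_range_reflect (fun x => A x * (w (x + 1) - w x)) m]
    refine sum_congr rfl fun x hx => ?_
    have hxm : x < m := mem_range.mp hx
    have e1 : m - 1 - x + 1 = m - x := by omega
    have e2 : w (m - x) = w x := (hwsym x hxm.le).symm
    have e3 : w (m - 1 - x) = w (x + 1) := by
      rw [hwsym (x + 1) (by omega)]
      congr 1
      omega
    simp only [e1, e2, e3]
  -- twice the sum, as a sum of nonpositive terms
  have h2S : (∑ x ∈ range m, A x * (w (x + 1) - w x)) + ∑ x ∈ range m, A x * (w (x + 1) - w x) =
      ∑ x ∈ range m, (A x - A (m - 1 - x)) * (w (x + 1) - w x) := by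
    nth_rewrite 2 [hS]
    rw [← sum_add_distrib]
    refine sum_congr rfl fun x _ => ?_
    ring
  have hterm : ∀ x ∈ range m, (A x - A (m - 1 - x)) * (w (x + 1) - w x) ≤ 0 := by
    intro x hx
    have hxm : x < m := mem_range.mp hx
    rcases le_or_gt (2 * x + 2) m with hsmall | hbig
    · -- lower half: A x ≤ A (m-1-x), increment ≥ 0
      exact mul_nonpos_of_nonpos_of_nonneg (sub_nonpos.mpr (hAref x hsmall))
        (sub_nonneg.mpr (hwuni x hsmall))
    · rcases eq_or_lt_of_le (Nat.succ_le_of_lt hbig) with heq | hgt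
      · -- the middle (m odd, 2x+1 = m): the increment vanishes
        have hw : w (x + 1) = w x := by
          rw [hwsym x hxm.le]
          congr 1
          omega
        simp [hw]
      · -- upper half: reflect `y = m-1-x`, which lies in the lower half
        have hy : 2 * (m - 1 - x) + 2 ≤ m := by omega
        have hA' : A (m - 1 - x) ≤ A x := by
          have := hAref (m - 1 - x) hy
          have e : m - 1 - (m - 1 - x) = x := by omega
          rwa [e] at this
        have hw' : w (x + 1) ≤ w x := by
          have h1 := hwuni (m - 1 - x) hy
          have e1 : w (m - 1 - x) = w (x + 1) := by
            rw [hwsym (x + 1) (by omega)]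
            congr 1
            omega
          have e2 : w (m - 1 - x + 1) = w x := by
            rw [hwsym x hxm.le]
            congr 1
            omega
          rw [e1, e2] at h1
          exact h1
        exact mul_nonpos_of_nonneg_of_nonpos (sub_nonneg.mpr hA') (sub_nonpos.mpr hw')
  have h2 : (∑ x ∈ range m, A x * (w (x + 1) - w x)) + ∑ x ∈ range m, A x * (w (x + 1) - w x)
      ≤ 0 := by
    rw [h2S]
    exact sum_nonpos hterm
  linarith

/-- **EXTENDED LEMMA Φ (note §5.3), unnormalised increment form.**  For `T = L + m ≤ 2k + 1`
(i.e. `k ≥ (T-1)/2`) and `w` symmetric about `m/2` and unimodal,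
`∑_{x<m} C(m,x)·(m-x)·C(L,k-x)·(w(x+1) - w(x)) ≤ 0`, where `C(L,k-x)` is read as `0` for `x > k`.
This is `(T-k)·C(T,k)·(E w(X_{k+1}) - E w(X_k))` for `X_k ~ Hyp(T;m;k)`. -/
theorem ext_lemma_phi (L m k : ℕ) (hk : L + m ≤ 2 * k + 1) (w : ℕ → ℝ)
    (hwsym : ∀ x, x ≤ m → w x = w (m - x)) (hwuni : ∀ x, 2 * x + 2 ≤ m → w x ≤ w (x + 1)) :
    ∑ x ∈ range m, ((m.choose x : ℝ) * ((m : ℝ) - x) *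
        (if x ≤ k then (L.choose (k - x) : ℝ) else 0)) * (w (x + 1) - w x) ≤ 0 := by
  -- the guarded second binomial factor
  set G : ℕ → ℝ := fun x => if x ≤ k then (L.choose (k - x) : ℝ) else 0 with hGdef
  refine reflect_sum_nonpos m (fun x => (m.choose x : ℝ) * ((m : ℝ) - x) * G x) w ?_ hwsym hwuni
  · -- the comparison `A x ≤ A (m-1-x)` in the lower half
    intro x hx
    have hx1 : x + 1 ≤ m := by omega
    -- rewrite both weights through `C(m,x+1)·(x+1)`
    have key1 : (m.choose x : ℝ) * ((m : ℝ) - x) = (m.choose (x + 1) : ℝ) * ((x : ℝ) + 1) := by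
      have h := Nat.choose_succ_right_eq m x      -- choose m (x+1) * (x+1) = choose m x * (m - x)
      have hcast : ((m.choose (x + 1) * (x + 1) : ℕ) : ℝ) = ((m.choose x * (m - x) : ℕ) : ℝ) := by
        rw [h]
      push_cast [Nat.cast_sub (by omega : x ≤ m)] at hcast
      linarith
    have key2 : (m.choose (m - 1 - x) : ℝ) * ((m : ℝ) - ((m - 1 - x : ℕ) : ℝ)) =
        (m.choose (x + 1) : ℝ) * ((x : ℝ) + 1) := by
      have e : m - 1 - x = m - (x + 1) := by omega
      rw [e, Nat.choose_symm hx1]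
      push_cast [Nat.cast_sub hx1]
      ring
    show (m.choose x : ℝ) * ((m : ℝ) - x) * G x ≤
      (m.choose (m - 1 - x) : ℝ) * ((m : ℝ) - ((m - 1 - x : ℕ) : ℝ)) * G (m - 1 - x)
    rw [key1, key2]
    refine mul_le_mul_of_nonneg_left ?_ (by positivity)
    -- compare the guarded binomials
    simp only [hGdef]
    by_cases hxk : x ≤ k
    · rw [if_pos hxk]
      by_cases hyk : m - 1 - x ≤ k
      · rw [if_pos hyk]
        have e : k - (m - 1 - x) = k + 1 + x - m := by omega
        rw [e]
        exact_mod_cast choose_le_choose_of_closer (L := L) (by omega) (by omega)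
      · rw [if_neg hyk]
        have hz : L < k - x := by omega
        simp [Nat.choose_eq_zero_of_lt hz]
    · rw [if_neg hxk]
      split_ifs <;> positivity

/-- Guarded hypergeometric factor `G L k x = C(L, k-x)` (`0` if `x > k`). -/
theorem guard_succ (L k y : ℕ) :
    (if y + 1 ≤ k + 1 then (L.choose (k + 1 - (y + 1)) : ℝ) else 0) =
      (if y ≤ k then (L.choose (k - y) : ℝ) else 0) := by
  by_cases hy : y ≤ k
  · rw [if_pos (by omega), if_pos hy]
    congr 2
    omega
  · rw [if_neg (by omega), if_neg hy]

/-- The Pascal-type step behind `X_{k+1} = X_k + ξ`, guarded form: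
`(k+1-x)·C(L,k+1-x) = (L-k+x)·C(L,k-x)` as reals. -/
theorem guard_pascal (L k x : ℕ) :
    ((k : ℝ) + 1 - x) * (if x ≤ k + 1 then (L.choose (k + 1 - x) : ℝ) else 0) =
      ((L : ℝ) - k + x) * (if x ≤ k then (L.choose (k - x) : ℝ) else 0) := by
  by_cases hxk : x ≤ k
  · rw [if_pos (by omega), if_pos hxk]
    have h := Nat.choose_succ_right_eq L (k - x)   -- C(L, k-x+1) * (k-x+1) = C(L,k-x) * (L - (k-x))
    have e1 : k + 1 - x = k - x + 1 := by omega
    rw [e1]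
    rcases le_or_gt (k - x) L with hle | hgt
    · have hcast : ((L.choose (k - x + 1) * (k - x + 1) : ℕ) : ℝ) =
          ((L.choose (k - x) * (L - (k - x)) : ℕ) : ℝ) := by rw [h]
      push_cast [Nat.cast_sub hle, Nat.cast_sub hxk] at hcast
      have e2 : ((k : ℝ) + 1 - x) = ((k : ℝ) - x + 1) := by ring
      rw [e2]
      linarith [hcast]
    · -- both binomials vanish
      have z1 : L.choose (k - x + 1) = 0 := Nat.choose_eq_zero_of_lt (by omega)
      have z2 : L.choose (k - x) = 0 := Nat.choose_eq_zero_of_lt hgt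
      simp [z1, z2]
  · by_cases hx1 : x ≤ k + 1
    · -- x = k+1
      have hx : x = k + 1 := by omega
      subst hx
      rw [if_pos le_rfl, if_neg (by omega)]
      push_cast
      ring
    · rw [if_neg hx1, if_neg hxk]
      ring

/-- **EXTENDED LEMMA Φ, monotone form (note §5.3).**  For `T = L + m ≤ 2k+1` and `w` symmetric
unimodal, `(k+1)·∑_x C(m,x)C(L,k+1-x) w(x) ≤ (T-k)·∑_x C(m,x)C(L,k-x) w(x)`; dividing by
`(k+1)·C(T,k+1) = (T-k)·C(T,k)` this is `E[w(X_{k+1})] ≤ E[w(X_k)]` for `X_k ~ Hyp(T; m; k)`. -/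
theorem ext_lemma_phi_mono (L m k : ℕ) (hk : L + m ≤ 2 * k + 1) (w : ℕ → ℝ)
    (hwsym : ∀ x, x ≤ m → w x = w (m - x)) (hwuni : ∀ x, 2 * x + 2 ≤ m → w x ≤ w (x + 1)) :
    ((k : ℝ) + 1) * ∑ x ∈ range (m + 1), (m.choose x : ℝ) *
        (if x ≤ k + 1 then (L.choose (k + 1 - x) : ℝ) else 0) * w x ≤
      ((L : ℝ) + m - k) * ∑ x ∈ range (m + 1), (m.choose x : ℝ) *
        (if x ≤ k then (L.choose (k - x) : ℝ) else 0) * w x := by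
  set G : ℕ → ℝ := fun x => if x ≤ k then (L.choose (k - x) : ℝ) else 0 with hGdef
  set G' : ℕ → ℝ := fun x => if x ≤ k + 1 then (L.choose (k + 1 - x) : ℝ) else 0 with hG'def
  have hmain := ext_lemma_phi L m k hk w hwsym hwuni
  -- termwise: (k+1) C(m,x) G' x = x C(m,x) G' x + (L-k+x) C(m,x) G x
  have hsplit : ((k : ℝ) + 1) * ∑ x ∈ range (m + 1), (m.choose x : ℝ) * G' x * w x =
      (∑ x ∈ range (m + 1), (x : ℝ) * (m.choose x : ℝ) * G' x * w x) +
        ∑ x ∈ range (m + 1), ((L : ℝ) - k + x) * (m.choose x : ℝ) * G x * w x := by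
    rw [mul_sum, ← sum_add_distrib]
    refine sum_congr rfl fun x _ => ?_
    have hp := guard_pascal L k x
    simp only [hGdef, hG'def] at hp ⊢
    have : ((k : ℝ) + 1) * ((m.choose x : ℝ) * (if x ≤ k + 1 then (L.choose (k + 1 - x) : ℝ) else 0) * w x)
        = ((x : ℝ) + ((k : ℝ) + 1 - x)) * (m.choose x : ℝ) *
          (if x ≤ k + 1 then (L.choose (k + 1 - x) : ℝ) else 0) * w x := by ring
    rw [this, add_mul, add_mul, add_mul]
    congr 1
    calc ((k : ℝ) + 1 - x) * (m.choose x : ℝ) * (if x ≤ k + 1 then (L.choose (k + 1 - x) : ℝ) else 0) * w x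
        = (m.choose x : ℝ) * (((k : ℝ) + 1 - x) * (if x ≤ k + 1 then (L.choose (k + 1 - x) : ℝ) else 0)) * w x := by ring
      _ = (m.choose x : ℝ) * (((L : ℝ) - k + x) * (if x ≤ k then (L.choose (k - x) : ℝ) else 0)) * w x := by rw [hp]
      _ = ((L : ℝ) - k + x) * (m.choose x : ℝ) * (if x ≤ k then (L.choose (k - x) : ℝ) else 0) * w x := by ring
  -- the first sum, reindexed: x C(m,x) G'(x) w x summed over x ≤ m  =  sum over y < m of (m-y) C(m,y) G y w(y+1)
  have hreindex : ∑ x ∈ range (m + 1), (x : ℝ) * (m.choose x : ℝ) * G' x * w x =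
      ∑ y ∈ range m, ((m : ℝ) - y) * (m.choose y : ℝ) * G y * w (y + 1) := by
    rw [sum_range_succ']
    simp only [Nat.cast_zero, zero_mul, add_zero]
    refine sum_congr rfl fun y hy => ?_
    have hym : y < m := mem_range.mp hy
    have hg : G' (y + 1) = G y := by
      simp only [hGdef, hG'def]
      exact guard_succ L k y
    have hc : ((y + 1 : ℕ) : ℝ) * (m.choose (y + 1) : ℝ) = ((m : ℝ) - y) * (m.choose y : ℝ) := by
      have h := Nat.choose_succ_right_eq m y
      have hcast : ((m.choose (y + 1) * (y + 1) : ℕ) : ℝ) = ((m.choose y * (m - y) : ℕ) : ℝ) := by rw [h]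
      push_cast [Nat.cast_sub hym.le] at hcast
      push_cast
      linear_combination hcast
    rw [hg]
    calc ((y + 1 : ℕ) : ℝ) * (m.choose (y + 1) : ℝ) * G y * w (y + 1)
        = (((y + 1 : ℕ) : ℝ) * (m.choose (y + 1) : ℝ)) * G y * w (y + 1) := by ring
      _ = (((m : ℝ) - y) * (m.choose y : ℝ)) * G y * w (y + 1) := by rw [hc]
      _ = ((m : ℝ) - y) * (m.choose y : ℝ) * G y * w (y + 1) := by ring
  -- the right-hand side split: (T-k) = (m-x) + (L-k+x)
  have hrhs : ((L : ℝ) + m - k) * ∑ x ∈ range (m + 1), (m.choose x : ℝ) * G x * w x =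
      (∑ x ∈ range (m + 1), ((m : ℝ) - x) * (m.choose x : ℝ) * G x * w x) +
        ∑ x ∈ range (m + 1), ((L : ℝ) - k + x) * (m.choose x : ℝ) * G x * w x := by
    rw [mul_sum, ← sum_add_distrib]
    refine sum_congr rfl fun x _ => ?_
    ring
  -- the x = m term of the first right-hand sum vanishes
  have hlast : ∑ x ∈ range (m + 1), ((m : ℝ) - x) * (m.choose x : ℝ) * G x * w x =
      ∑ x ∈ range m, ((m : ℝ) - x) * (m.choose x : ℝ) * G x * w x := by
    rw [sum_range_succ]
    simp
  -- assemble
  have hdiff : ((k : ℝ) + 1) * ∑ x ∈ range (m + 1), (m.choose x : ℝ) * G' x * w x -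
      ((L : ℝ) + m - k) * ∑ x ∈ range (m + 1), (m.choose x : ℝ) * G x * w x =
      ∑ x ∈ range m, ((m.choose x : ℝ) * ((m : ℝ) - x) * G x) * (w (x + 1) - w x) := by
    rw [hsplit, hreindex, hrhs, hlast]
    have : ∑ x ∈ range m, ((m.choose x : ℝ) * ((m : ℝ) - x) * G x) * (w (x + 1) - w x) =
        (∑ x ∈ range m, ((m : ℝ) - x) * (m.choose x : ℝ) * G x * w (x + 1)) -
          ∑ x ∈ range m, ((m : ℝ) - x) * (m.choose x : ℝ) * G x * w x := by
      rw [← sum_sub_distrib]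
      refine sum_congr rfl fun x _ => ?_
      ring
    rw [this]
    ring
  have hmain' : ∑ x ∈ range m, ((m.choose x : ℝ) * ((m : ℝ) - x) * G x) * (w (x + 1) - w x) ≤ 0 := by
    simpa only [hGdef] using hmain
  have := sub_nonpos.mp (by rw [hdiff]; exact hmain')
  simpa only [hGdef, hG'def] using this

end HypergeomPeak

end Summit.CriticalPhenomena.PercolationContinuityZ3.Theorems
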